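import Summits.AtomisticToContinuum.FouriersLaw.Theses.EmbeddedDrudeMourre
import Literature.MathematicalPhysics.KineticTheory.InfiniteChainAbelWitness
import Literature.MathematicalPhysics.KineticTheory.InfiniteChainAmplitudeScaling

/-!
# Disproof of `DrudeDissolution` (stmt-AtomisticToContinuum-12593) — findings of the standing adversary

Crux (route `EmbeddedDrudeMourre`, rank 0, the route's TARGET, auto-crux): for `pinnedChain ω₂ lam β γ`
(`U = ω₂q²/2 + lam q⁴/4`, `V = r²/2 + βr⁴/4`, all four parameters `> 0`) there is `T₀ > 0` such
that every `T ∈ (0, T₀)` carries a SPECTRAL WITNESS (`SpectralWitness`, §1): a DLR Gibbs state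
`μ_T`, a `μ_T`-preserving `InfiniteChainDynamics` with absolutely convergent summed current
correlations `C_T(t) = Σ_x ∫ j_0 (j_x∘φ_t) dμ_T`, a finite measure `σ_T` on `ℝ` with
`C_T(t) = ∫ cos(ωt) dσ_T(ω)` for all `t`, and a window `(−δ, δ)` on which `σ_T = g dω`, `g`
continuous, `≥ 0`, `g 0 > 0`.

VERDICT (cycle 1, 2026-08-16): **RESISTS — no kill; not refutable by anything in print or in the
tree.** By `not_drudeDissolution_iff` (§3d) a disproof must exhibit ONE coupling direction
`(a, b)` and anharmonicities `ε_n ↓ 0` such that the UNIT-temperature chains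
`pinnedChain ω₂ (aε_n) (bε_n)` have NO spectral witness — i.e. a ballistic component (Drude atom,
`le_atom_of_floor` / `le_atom_of_frequently_cesaro`) or a singular / discontinuous low-frequency
current spectrum persisting at arbitrarily weak but non-zero anharmonicity, for EVERY DLR state
and EVERY preserving dynamics. Known mechanisms and why each misses: (1) Mazur atom from a
conserved charge odd under momentum reversal overlapping `J` — at `ε = 0` the charge is `J`
itself (`hasDerivAt_bondCurrentZ_harmonic`, §4), but for `ε > 0` no local/quasi-local odd
conserved charge of the doubly-quartic pinned chain is known (momentum is broken by pinning, the
stretch is even with zero current susceptibility; the phonon NUMBER quasi-conservation of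
Huveneers–Lukkarinen lives in the even sector); an isolated integrable coupling would not even
suffice (germ form, `drudeDissolution_iff_eventually`); (2) non-integrable tail of `C_T` without a
conserved current: no printed mechanism for a pinned (momentum non-conserving) chain — the
single diffusive field (energy) contributes no mode-coupling tail to the TOTAL current (gradient
nonlinearities integrate to zero), kinetic theory predicts `C(λ⁻²t) ≈ ⟨j, e^{−|t|L} j⟩` with a
finite positive `κ ∝ (λT)⁻²` (ALS06 §2–3, (2.14): "the limit `T → 0` … corresponds to the limit
`λ → 0`", materialised `paper:galaxy-pdf-1225612559323412660` p0004), and all MD on pinned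
anharmonic chains is normal (ALS06 §5; BLR00 §10 item 1) — the ONE printed doubt, and the only
source of failure mode (b) of the route card (a singular / infinite density at `0` despite
pinning), is ALS06's own caveat on the 1-D kinetic derivation (p0007): "even the claim (3.25),
(3.26) is tentative … The oscillatory time integrals for the chain have a slower decay and the
rough estimates used so far are not sufficient to justify the separation into leading and
subleading diagrams" — no quantitative anomaly is claimed anywhere; (3) junk / degenerate witnesses are
all excluded by the clauses as typed (§3a–c). Conversely NO theorem produces a spectral witness
for any deterministic anharmonic lattice (BLR00 §7), so the crux is conjecture-grade, as filed.
Literature services were DEGRADED this cycle (local fts db unavailable, OpenAlex/S2 HTTP 429,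
galaxy substring 0 rows): nothing here rests on a search that could not run.

## Tree map (durable homes — import these, not this workfile)
* `Summits/AtomisticToContinuum/FouriersLaw/Theorems/DrudeDissolution/Negative/SpectralPairNecessities.lean`
  (p82090, ACCEPTED, commit 42ef2b33fc0c): §2 (`cosine_zero/even`, `abs_cosine_le`,
  `continuous_cosine`, `cosine_posSemidef`, `atom_eq_zero_of_window`, `integral_cos_mul_eq`,
  `cesaro_eq_integral_sinc`, `tendsto_cesaro_atom`, `tendsto_cesaro_zero_of_window`,
  `le_atom_of_frequently_cesaro`, `not_window_of_frequently_cesaro`, `le_atom_of_floor`,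
  `not_window_of_floor`, `measure_window_pos`, `not_window_of_conserved(₀)`), namespace
  `Summit.AtomisticToContinuum.FouriersLaw.Theorems.DrudeDissolution.Negative`.
* `…/Negative/WeakAnharmonicityForm.lean` (p82638, ACCEPTED, commit 22b4beb4765b): §1/§3/§4 with
  `SpectralWitness` spelled out (`drudeDissolution_iff`, `exists_witness_transport`,
  `exists_witness_iff_unit_temp`, `drudeDissolution_iff_gamma_one`,
  `drudeDissolution_iff_weak_anharmonicity`, `not_drudeDissolution_iff`,
  `drudeDissolution_false_without_temp_pos`, `exists_laxWitness`, `measure_momentum_eq_zero`,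
  `not_identity_flow`, `hasDerivAt_bondCurrentZ_harmonic`).
* `…/Negative/WindowNotL1.lean` (p84837, dry-run ACCEPT, pending): §5 (`integral_cos_mul_gaussian`,
  `not_integrableOn_cos_two_mul`, `exists_window_not_integrable`).

## Findings index (all PROVED unless marked; `lean check` rc 0, ONE `sorry` = the §4 near-miss)

§1 SHAPE — `SpectralWitness`, `drudeDissolution_iff` (`Iff.rfl`), `drudeDissolution_iff_eventually`
  (GERM FORM at `T = 0⁺`: an isolated bad temperature / coupling never refutes),
  `not_mourreDissolution_of_not_drudeDissolution` (kill criterion (c): `FGRGap ∧ ¬target ⇒ ¬engine`),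
  `not_drudeDissolution_of_frequently_no_abelWitness` (CHEAPEST KILL INTERFACE: modulo the
  provable support `AbelOfSpectralDensity`, frequent failure of ABELIAN witnesses as `T ↓ 0` refutes).
§2 NECESSARY CONDITIONS of `C = ∫cos dσ` (pure analysis, Mathlib only; the refuter's handles and
  the prover's obligations on `currentCorrelation`): `cosine_zero` (`C 0 = σ(ℝ)`), `cosine_even`,
  `abs_cosine_le` (`|C t| ≤ C 0`), `continuous_cosine`, `cosine_posSemidef` (Bochner's easy half:
  `Σᵢⱼ cᵢcⱼC(tᵢ−tⱼ) ≥ 0`); `atom_eq_zero_of_window` (**window density ⇒ NO DRUDE ATOM**);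
  `integral_cos_mul_eq`, `cesaro_eq_integral_sinc`, `tendsto_cesaro_atom` (**WIENER LEMMA**:
  `R⁻¹∫₀^R C → σ{0}`), `tendsto_cesaro_zero_of_window`, `le_atom_of_frequently_cesaro` +
  `not_window_of_frequently_cesaro` (**MAZUR HANDLE**: Cesàro means frequently `≥ d > 0` ⇒ atom
  `≥ d` ⇒ no witness), `le_atom_of_floor` + `not_window_of_floor` (a Drude FLOOR `C ≥ d > 0` for
  `t ≥ t₀` kills every window), `not_window_of_conserved`, `measure_window_pos` (a window carries
  positive spectral mass: `C 0 = σ(ℝ) > 0`), `not_window_of_conserved₀` (conserved `C`, no sign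
  hypothesis ⇒ no window); `SpectralWitness.cesaro_zero`.
§3 LOAD-BEARING ANALYSIS —
  §3a `SpectralWitness.temp_pos`, `drudeDissolution_false_without_temp_pos` (the guard `0 < T`
  cannot be dropped: no DLR state at `T ≤ 0`, Gibbs kernel = junk `0`);
  §3b `SpectralWitness.of_gamma`, `spectralWitness_gamma_irrel`, `drudeDissolution_iff_gamma_free`
  (**`0 < γ` IS DECORATION** — the crux is about the closed chain `(ω₂, lam, β)`);
  §3c `laxSpectralWitness_all` (Gibbs ↦ probability and `0 < g 0` ↦ `0 ≤ g 0` make the conclusion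
  JUNK-TRUE everywhere: rest dynamics, `σ = 0`), `measure_momentum_eq_zero` (DLR states charge no
  hyperplane `p₀ = v`), `not_identity_flow` (**the identity flow is excluded** by
  `PreservesMeasure` + Gibbs: certified version of the route-review note);
  §3d **LOW TEMPERATURE IS WEAK ANHARMONICITY**: `SpectralWitness.transport` (`σ ↦ s⁴σ`, `g ↦ s⁴g`,
  same window), `spectralWitness_iff_unit_temp` (`SW(lam,β;T) ⇔ SW(lamT,βT;1)`),
  `SpectralWitness.conjugacyClass`, `drudeDissolution_iff_weak_anharmonicity` (THE CRUX ⇔ every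
  coupling ray `ε ↦ (aε, bε)` has unit-temperature witnesses near `ε = 0`),
  `not_drudeDissolution_iff` / `_frequently` (**REFUTATION SHAPE**),
  `drudeDissolution_iff_unit_threshold` (`T₀` normalisable to `1`).
§4 HARMONIC ENDPOINT — `harmonicCurrentFlux`, `hasDerivAt_bondCurrentZ_harmonic` (**local
  conservation law `d/dt j_x = k_x − k_{x+1}` of the pinned harmonic chain**, every solution:
  the Mazur charge `Q = J`), `not_window_of_conserved`; NEAR-MISS `harmonic_no_spectralWitness`
  (`sorry`; obstruction = joint measurability of the flow + summability of `⟨|j₀| |k_x∘φ_s|⟩` for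
  an ARBITRARY witness dynamics, and non-tempered Gaussian DLR states) — what
  `drudeDissolution_false_without_anharmonicity` would need.
§5 STRENGTHENING REFUTED — `integral_cos_mul_gaussian` (`∫cos(ωt)e^{-ω²/2}dω = √(2π)e^{-t²/2}`),
  `not_integrableOn_cos_two_mul`, `exists_window_not_integrable` (**window density ⇏ `C ∈ L¹`**:
  `σ = e^{-ω²/2}dω + δ_2`; the crux's conclusion is strictly weaker than `HasGreenKubo` of stmt-0703
  — atoms / singular spectrum AWAY from `0` are allowed and harmless for the Abel limit).

## Mutation findings (information for provers/planners)
* `0 < γ`: unnecessary (proved, §3b). * `0 < T`: maximal and necessary (§3a).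
* `0 < lam` ALONE or `0 < β` ALONE: POSSIBLY UNNECESSARY — `β = 0` is ALS06's `φ⁴` chain and
  `lam = 0, β > 0` the pinned FPU-β chain; kinetic theory and MD expect dissolution in both; only the
  JOINT endpoint `lam = β = 0` is fatal (§4). The crux could be stated for `0 ≤ lam, 0 ≤ β,
  0 < lam + β` without known counterexample (not a request — the conjunct fixes `lam, β > 0`).
* `T < T₀`: dropping it gives all-`T` dissolution ⇒ `AbelianGreenKuboAllT` of the sibling
  `GreenKuboContinuation` workfile (open, expected true, not attackable).
* `0 < ω₂`: dropping it (`ω₂ = 0`, `lam > 0`: purely quartic pinning) keeps a pinned,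
  momentum-non-conserving chain; the harmonic reference becomes ACOUSTIC and the kinetic corner
  changes character (no gap of the dispersion at `k = 0`), but no counterexample is known.
* Strengthenings NOT implied and deliberately not claimed by the planner: `C_T ∈ L¹` (PROVED false
  in general, §5: `σ = e^{-ω²/2}dω + δ_2` has a perfect window yet `C ∉ L¹(0,∞)`), window uniform
  in `T` (impossible: `σ_T(ℝ) = C_T(0) = O(T²)` while `g_T(0) = O(1)` is expected), `g`
  differentiable at `0` (mode-coupling cusps `|ω|^{1/2}` would be compatible with the crux).
* INTERFACE CAVEAT for provers (not an attack): `InfiniteChainDynamics.unique` quantifies over ALL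
  solution curves that are merely pointwise-in-time in the carrier — stronger than the uniqueness
  classes of LLL77 Thm 2/4 and Marchioro–Pellegrinotti–Pulvirenti (sup over compact time intervals
  of a tempered norm); the existence of an INVARIANT infinite-volume dynamics for quartic `V` with
  this field is part of the crux (route-review note of 2026-08-15 stands).

## MD probe (kit job j013239, evidence auto-attached; `mdprobe/main.py`, numpy velocity-Verlet)
Closed periodic `pinnedChain 1 1 1 ·`, `N = 1024`, `dt = 0.04`, `2²⁰` NVE steps after Langevin
equilibration (`t_max ≈ 4.2·10⁴`), 3 seeds per `T`, total current `J = Σ_x j_x` recorded; `C(t) =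
⟨J(0)J(t)⟩/N`. Numbers (seed averages): Cesàro DRUDE FRACTION `R⁻¹∫₀^R C / C(0)` at
`R = t_max/4 → t_max/2`: `T = 1: 0.006 → 0.006`, `0.5: 0.019 → 0.006`, `0.2: 0.08 → 0.05`,
`0.1: 0.05 → 0.007`, `0.05: 0.34 → 0.29` (seeds 0.70/0.60, 0.13/0.12, 0.19/0.15); Green–Kubo
running integrals `T⁻²∫₀^τ C`, `τ = 10³ → 4·10³`: `T = 1: 26 → 29`, `0.5: 51 → 76`, `0.2: 126 → 268`,
`0.1: 112 → 129`, `0.05: 186 → 518`; `T²κ`: `27 (T=1)`, `≈ 1.3 (T = 0.1)`, `≥ 1.3 (T = 0.05)`,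
`κ(0.05)/κ(0.1) ≳ 4 ≈ (ratio of T)⁻²`. READING: no Drude weight is seen for `T ≥ 0.1` (Cesàro
fractions at the few-% noise floor and DEcreasing in `R`), the central peak of the current
spectrum narrows as `T` decreases and `κ_GK` stays finite, growing roughly like `T⁻²` between
`0.1` and `0.05` — consistent with DISSOLUTION, nothing ballistic; the `T = 0.05` point is
UNRESOLVED (correlation time `≳ 4·10³ ≈ t_max/10`, one seed carrying a persistent current over
the run) and finite-size contaminated (kinetic mean free path `≳ N` below `T ≈ 0.1`): a decisive
low-`T` scan needs `N ∝ T⁻²`, `t_max ∝ T⁻²` (cost `∝ T⁻⁴`), not a numpy afternoon. The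
log–log-slope and spike-ratio columns of the job table are dominated by the Lorentzian roll-off
inside the fitting band at low `T` and carry no cusp information (design limitation, recorded).

## Census of attacks (cycle 1)
junk witnesses (σ = 0 / rest dynamics / Dirac state / identity flow / `T ≤ 0`) → all excluded by
the typed clauses (§3a, §3c); `γ`-mutation → decoration (§3b); scaling → the crux is the
weak-coupling germ at `T = 1` (§3d), so Mazur charges must persist for a sequence `ε_n ↓ 0` —
none known; MD probe j013239 → no Drude weight for T ≥ 0.1, T=0.05 unresolved (above);
harmonic endpoint → conserved current proved pointwise (§4), full no-witness theorem
= near-miss; literature (degraded) → ALS06 scaling + kinetic picture consistent with the crux,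
no printed anomaly for pinned chains; barrier catalogue (`HarmonicCrystalBallistic`,
`MazurBoundBallistic*`, `LowTemperatureWeakAnharmonicity`, `FPUBetaKineticAnomaly*` = unpinned,
`AnticontinuumLocalization*` = other corner, finite times) → none bites at `lam, β > 0`, small `T`.
-/

noncomputable section

namespace Summit.AtomisticToContinuum.FouriersLaw.Cruxes.DrudeDissolution.Disproof

open MeasureTheory Filter Set Topology
open scoped ENNReal
open Literature.MathematicalPhysics.KineticTheory.HeatConduction
open Literature.Probability.LatticeModels
open Summit.AtomisticToContinuum.FouriersLaw.Theses.EmbeddedDrudeMourre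

/-! ## §1 Shape of the crux -/

/-- SPECTRAL WITNESS at `(ω₂, lam, β, γ; T)`: the conclusion of the crux at one parameter point —
a DLR Gibbs state `μT` of `pinnedChain ω₂ lam β γ` at `T`, a `μT`-preserving infinite-volume
dynamics with absolutely convergent current correlations, a finite CURRENT SPECTRAL MEASURE `σ`
with `C_T(t) = ∫ cos (ω t) dσ(ω)` for all `t`, and a window `(−δ, δ)` on which `σ = g dω` with `g`
continuous, non-negative and `g 0 > 0`. -/
def SpectralWitness (ω₂ lam β γ T : ℝ) : Prop :=
  ∃ (μT : Measure ChainConfig) (D : InfiniteChainDynamics (pinnedChain ω₂ lam β γ)),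
    (pinnedChain ω₂ lam β γ).IsChainGibbsMeasure T μT ∧ D.PreservesMeasure μT ∧
      (∀ t : ℝ, D.HasAbsConvergentCorrelation μT t) ∧
        ∃ σ : Measure ℝ, IsFiniteMeasure σ ∧
          (∀ t : ℝ, D.currentCorrelation μT t = ∫ ω, Real.cos (ω * t) ∂σ) ∧
            ∃ (δ : ℝ) (g : ℝ → ℝ), 0 < δ ∧ ContinuousOn g (Ioo (-δ) δ) ∧
              (∀ ω ∈ Ioo (-δ) δ, 0 ≤ g ω) ∧ 0 < g 0 ∧
                σ.restrict (Ioo (-δ) δ) =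
                  (volume.restrict (Ioo (-δ) δ)).withDensity fun ω => ENNReal.ofReal (g ω)

/-- The crux read back: `DrudeDissolution` is "for all positive parameters, spectral witnesses on
some initial temperature segment" (definitional unfolding). -/
theorem drudeDissolution_iff :
    DrudeDissolution ↔ ∀ ω₂ lam β γ : ℝ, 0 < ω₂ → 0 < lam → 0 < β → 0 < γ →
      ∃ T₀ : ℝ, 0 < T₀ ∧ ∀ T : ℝ, 0 < T → T < T₀ → SpectralWitness ω₂ lam β γ T :=
  Iff.rfl

/-- GERM FORM: the threshold `T₀` is used only existentially, so the crux is a statement about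
the germ at `T = 0⁺`: witnesses for all sufficiently small `T > 0`. An isolated bad temperature
(e.g. an isolated integrable coupling on the ray, §3) can never refute it. -/
theorem drudeDissolution_iff_eventually :
    DrudeDissolution ↔ ∀ ω₂ lam β γ : ℝ, 0 < ω₂ → 0 < lam → 0 < β → 0 < γ →
      ∀ᶠ T in 𝓝[>] (0 : ℝ), SpectralWitness ω₂ lam β γ T := by
  rw [drudeDissolution_iff]
  refine forall₄_congr fun ω₂ lam β γ => ?_
  refine imp_congr_right fun _ => imp_congr_right fun _ => imp_congr_right fun _ =>
    imp_congr_right fun _ => ?_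
  rw [(nhdsGT_basis (0 : ℝ)).eventually_iff]
  constructor
  · rintro ⟨T₀, hT₀, h⟩
    exact ⟨T₀, hT₀, fun T hT => h T hT.1 hT.2⟩
  · rintro ⟨T₀, hT₀, h⟩
    exact ⟨T₀, hT₀, fun T hT hlt => h ⟨hT, hlt⟩⟩

/-- KILL CRITERION (c) OF THE ROUTE, formally: a refutation of the target with the kinetic input
`FGRGap` intact refutes the engine `MourreDissolution` (contrapositive of the support `EngineGlue`,
which is modus ponens). So every `¬ DrudeDissolution` witness is handed to `MourreDissolution`. -/
theorem not_mourreDissolution_of_not_drudeDissolution (hgap : FGRGap) (h : ¬ DrudeDissolution) :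
    ¬ MourreDissolution := fun hM =>
  h fun ω₂ lam β γ hω hl hβ hγ => hM ω₂ lam β γ hω hl hβ hγ (hgap ω₂ lam β hω hl hβ)

/-- **IT SUFFICES TO KILL THE ABELIAN WITNESS.** Given the (provable-now) Poisson-kernel support
item `AbelOfSpectralDensity`, every spectral witness is an Abelian Green–Kubo witness
(`T⁻²∫₀^∞e^{−νt}C_T → κ > 0`); hence if in some admissible parameter point the Abelian witnesses
fail FREQUENTLY as `T ↓ 0` (no `σ`, no window needed — e.g. `κ_A(T_n) = ∞` or a non-existent Abel
limit along `T_n ↓ 0`), the crux is false. This is the cheapest refutation interface; it is also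
`¬ KineticCorner` of the sibling workfile `Cruxes/GreenKuboContinuation/Disproof.lean`. -/
theorem not_drudeDissolution_of_frequently_no_abelWitness (hA : AbelOfSpectralDensity)
    {ω₂ lam β γ : ℝ} (hω : 0 < ω₂) (hl : 0 < lam) (hβ : 0 < β) (hγ : 0 < γ)
    (h : ∃ᶠ T in 𝓝[>] (0 : ℝ), ¬ ∃ (μT : Measure ChainConfig)
      (D : InfiniteChainDynamics (pinnedChain ω₂ lam β γ)) (κ : ℝ),
      (pinnedChain ω₂ lam β γ).IsChainGibbsMeasure T μT ∧ D.PreservesMeasure μT ∧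
        (∀ t : ℝ, D.HasAbsConvergentCorrelation μT t) ∧ 0 < κ ∧
          Tendsto (fun ν : ℝ => (T ^ 2)⁻¹ * ∫ t in Ioi (0 : ℝ),
            Real.exp (-(ν * t)) * D.currentCorrelation μT t) (𝓝[>] (0 : ℝ)) (𝓝 κ)) :
    ¬ DrudeDissolution := by
  intro hDD
  have hev := (drudeDissolution_iff_eventually.1 hDD) ω₂ lam β γ hω hl hβ hγ
  have hpos : ∀ᶠ T in 𝓝[>] (0 : ℝ), 0 < T := eventually_mem_nhdsWithin
  refine ((hev.and hpos).and_frequently h).exists.elim fun T hT => ?_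
  obtain ⟨⟨hW, hT0⟩, hno⟩ := hT
  obtain ⟨μT, D, hG, hP, hAC, σ, hσ, hCσ, δ, g, hδ, hg, hg0, hgpos, hac⟩ := hW
  exact hno ⟨μT, D, (T ^ 2)⁻¹ * (Real.pi * g 0), hG, hP, hAC,
    mul_pos (inv_pos.mpr (pow_pos hT0 2)) (mul_pos Real.pi_pos hgpos),
    (hA σ (D.currentCorrelation μT) δ g hσ hδ hCσ hg hg0 hac).const_mul ((T ^ 2)⁻¹)⟩

/-! ## §2 Necessary conditions carried by a cosine-transform representation

Pure analysis: what `C(t) = ∫ cos(ωt) dσ(ω)` with a finite `σ` and a window density force on `C`.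
These are the refuter's handles: any `(μ, D)` whose summed current autocorrelation violates one of
them is not a witness. -/

section CosineTransform

variable {C : ℝ → ℝ} {σ : Measure ℝ}

/-- `C(0) = σ(ℝ)`: the total spectral mass is the static current susceptibility. -/
theorem cosine_zero [IsFiniteMeasure σ] (hC : ∀ t : ℝ, C t = ∫ ω, Real.cos (ω * t) ∂σ) :
    C 0 = σ.real univ := by
  rw [hC 0]
  simp [integral_const]

/-- `C` is even. -/
theorem cosine_even (hC : ∀ t : ℝ, C t = ∫ ω, Real.cos (ω * t) ∂σ) (t : ℝ) : C (-t) = C t := by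
  rw [hC, hC]
  simp [mul_neg, Real.cos_neg]

/-- `|C(t)| ≤ C(0)`. -/
theorem abs_cosine_le [IsFiniteMeasure σ] (hC : ∀ t : ℝ, C t = ∫ ω, Real.cos (ω * t) ∂σ) (t : ℝ) :
    |C t| ≤ C 0 := by
  rw [cosine_zero hC, hC t]
  have h := norm_integral_le_of_norm_le_const (μ := σ) (f := fun ω => Real.cos (ω * t)) (C := 1)
    (Eventually.of_forall fun ω => by
      rw [Real.norm_eq_abs]; exact Real.abs_cos_le_one _)
  rw [one_mul] at h
  simpa [Real.norm_eq_abs] using h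

/-- `C` is continuous (dominated convergence). -/
theorem continuous_cosine [IsFiniteMeasure σ] (hC : ∀ t : ℝ, C t = ∫ ω, Real.cos (ω * t) ∂σ) :
    Continuous C := by
  have : C = fun t => ∫ ω, Real.cos (ω * t) ∂σ := funext hC
  rw [this]
  refine continuous_of_dominated (bound := fun _ => (1 : ℝ)) ?_ ?_ (integrable_const 1) ?_
  · intro t
    exact (Real.continuous_cos.comp (continuous_id.mul continuous_const)).aestronglyMeasurable
  · intro t
    exact Eventually.of_forall fun ω => by
      rw [Real.norm_eq_abs]; exact Real.abs_cos_le_one _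
  · exact Eventually.of_forall fun ω => Real.continuous_cos.comp (continuous_const.mul continuous_id)

/-- `C` is POSITIVE SEMI-DEFINITE (the easy half of Bochner): for all finite families,
`Σᵢⱼ cᵢ cⱼ C(tᵢ − tⱼ) = ∫ [(Σ cᵢ cos ωtᵢ)² + (Σ cᵢ sin ωtᵢ)²] dσ ≥ 0`. -/
theorem cosine_posSemidef [IsFiniteMeasure σ] (hC : ∀ t : ℝ, C t = ∫ ω, Real.cos (ω * t) ∂σ)
    {n : ℕ} (c τ : Fin n → ℝ) :
    0 ≤ ∑ i, ∑ j, c i * c j * C (τ i - τ j) := by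
  have hint : ∀ i j : Fin n,
      Integrable (fun ω => c i * c j * Real.cos (ω * (τ i - τ j))) σ := fun i j =>
    ((integrable_const (1 : ℝ)).mono'
      ((Real.continuous_cos.comp (continuous_id.mul continuous_const)).aestronglyMeasurable)
      (Eventually.of_forall fun ω => by
        rw [Real.norm_eq_abs]; exact Real.abs_cos_le_one _)).const_mul (c i * c j)
  have key : ∀ ω : ℝ, ∑ i, ∑ j, c i * c j * Real.cos (ω * (τ i - τ j)) =
      (∑ i, c i * Real.cos (ω * τ i)) ^ 2 + (∑ i, c i * Real.sin (ω * τ i)) ^ 2 := by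
    intro ω
    have hcos : ∀ i j : Fin n, Real.cos (ω * (τ i - τ j)) =
        Real.cos (ω * τ i) * Real.cos (ω * τ j) + Real.sin (ω * τ i) * Real.sin (ω * τ j) := by
      intro i j; rw [mul_sub, Real.cos_sub]
    simp_rw [hcos, sq, Finset.sum_mul_sum, ← Finset.sum_add_distrib]
    refine Finset.sum_congr rfl fun i _ => Finset.sum_congr rfl fun j _ => ?_
    ring
  have hrepr : ∑ i, ∑ j, c i * c j * C (τ i - τ j) =
      ∫ ω, ∑ i, ∑ j, c i * c j * Real.cos (ω * (τ i - τ j)) ∂σ := by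
    rw [integral_finsetSum _ (fun i _ => integrable_finsetSum _ fun j _ => hint i j)]
    refine Finset.sum_congr rfl fun i _ => ?_
    rw [integral_finsetSum _ (fun j _ => hint i j)]
    refine Finset.sum_congr rfl fun j _ => ?_
    rw [hC, integral_const_mul]
  rw [hrepr]
  refine integral_nonneg fun ω => ?_
  show (0 : ℝ) ≤ _
  rw [key ω]
  positivity

/-! ### No Drude atom, and the Cesàro (Mazur) handle -/

/-- A WINDOW DENSITY EXCLUDES A DRUDE ATOM: if `σ = g dω` on `(−δ, δ)` then `σ {0} = 0`. So the
crux's conclusion is incompatible with any ballistic component of the current (kill criterion (a)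
of the route is literally the negation of a clause of the conclusion). -/
theorem atom_eq_zero_of_window {δ : ℝ} {g : ℝ → ℝ} (hδ : 0 < δ)
    (hw : σ.restrict (Ioo (-δ) δ) =
      (volume.restrict (Ioo (-δ) δ)).withDensity fun ω => ENNReal.ofReal (g ω)) :
    σ {0} = 0 := by
  have h0 : (0 : ℝ) ∈ Ioo (-δ) δ := ⟨by linarith, hδ⟩
  have h1 : σ {0} = σ.restrict (Ioo (-δ) δ) {0} := by
    rw [Measure.restrict_apply (measurableSet_singleton 0), inter_eq_left.mpr (singleton_subset_iff.2 h0)]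
  rw [h1, hw]
  refine withDensity_absolutelyContinuous _ _ ?_
  rw [Measure.restrict_apply (measurableSet_singleton 0)]
  exact measure_mono_null inter_subset_left (by simp)

/-- The CESÀRO KERNEL: `∫₀^R cos(ω t) dt = R · sinc(ω R)`. -/
theorem integral_cos_mul_eq (ω R : ℝ) :
    ∫ t in (0 : ℝ)..R, Real.cos (ω * t) = R * Real.sinc (ω * R) := by
  by_cases hω : ω = 0
  · subst hω
    simp
  · by_cases hR : R = 0
    · subst hR
      simp
    rw [intervalIntegral.integral_comp_mul_left (fun x => Real.cos x) hω, integral_cos,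
      Real.sinc_of_ne_zero (mul_ne_zero hω hR)]
    simp only [mul_zero, Real.sin_zero, sub_zero, smul_eq_mul]
    field_simp

/-- `|sinc x| ≤ |x|⁻¹`. -/
theorem abs_sinc_le_inv_abs {x : ℝ} (hx : x ≠ 0) : |Real.sinc x| ≤ |x|⁻¹ := by
  rw [Real.sinc_of_ne_zero hx, abs_div]
  rw [div_eq_mul_inv]
  exact mul_le_of_le_one_left (inv_nonneg.mpr (abs_nonneg x)) (Real.abs_sin_le_one x)

/-- For `R > 0`, the Cesàro mean of `C` over `[0, R]` is `∫ sinc(ω R) dσ(ω)` (Fubini). -/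
theorem cesaro_eq_integral_sinc [IsFiniteMeasure σ]
    (hC : ∀ t : ℝ, C t = ∫ ω, Real.cos (ω * t) ∂σ) {R : ℝ} (hR : 0 < R) :
    R⁻¹ * ∫ t in (0 : ℝ)..R, C t = ∫ ω, Real.sinc (ω * R) ∂σ := by
  have hCeq : (fun t => C t) = fun t => ∫ ω, Real.cos (ω * t) ∂σ := funext hC
  rw [hCeq, intervalIntegral.integral_of_le hR.le]
  -- Fubini on the finite product `Ioc 0 R × σ`
  have hswap : ∫ t in Ioc (0 : ℝ) R, ∫ ω, Real.cos (ω * t) ∂σ =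
      ∫ ω, (∫ t in Ioc (0 : ℝ) R, Real.cos (ω * t)) ∂σ := by
    refine integral_integral_swap (μ := volume.restrict (Ioc (0 : ℝ) R)) (ν := σ)
      (f := fun t ω => Real.cos (ω * t)) ?_
    refine (integrable_const (1 : ℝ)).mono' ?_ (Eventually.of_forall fun p => ?_)
    · exact (Real.continuous_cos.comp (continuous_snd.mul continuous_fst)).aestronglyMeasurable
    · rw [Real.norm_eq_abs]
      exact Real.abs_cos_le_one _
  rw [hswap]
  have hinner : ∀ ω : ℝ, ∫ t in Ioc (0 : ℝ) R, Real.cos (ω * t) = R * Real.sinc (ω * R) := by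
    intro ω
    rw [← intervalIntegral.integral_of_le hR.le, integral_cos_mul_eq]
  simp_rw [hinner]
  rw [integral_const_mul, ← mul_assoc, inv_mul_cancel₀ hR.ne', one_mul]

/-- **WIENER / CESÀRO LEMMA.** If `C(t) = ∫ cos(ωt) dσ` with `σ` finite, the Cesàro means of `C`
converge to the DRUDE WEIGHT `σ{0}`: `R⁻¹ ∫₀^R C(t) dt → σ{0}` as `R → ∞`. -/
theorem tendsto_cesaro_atom [IsFiniteMeasure σ] (hC : ∀ t : ℝ, C t = ∫ ω, Real.cos (ω * t) ∂σ) :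
    Tendsto (fun R : ℝ => R⁻¹ * ∫ t in (0 : ℝ)..R, C t) atTop (𝓝 (σ.real {0})) := by
  have hlim : Tendsto (fun R : ℝ => ∫ ω, Real.sinc (ω * R) ∂σ) atTop
      (𝓝 (∫ ω, ({0} : Set ℝ).indicator 1 ω ∂σ)) := by
    refine tendsto_integral_filter_of_dominated_convergence (fun _ => (1 : ℝ)) ?_ ?_
      (integrable_const 1) ?_
    · exact Eventually.of_forall fun R =>
        (Real.continuous_sinc.comp (continuous_id.mul continuous_const)).aestronglyMeasurable
    · exact Eventually.of_forall fun R => Eventually.of_forall fun ω => by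
        rw [Real.norm_eq_abs]; exact Real.abs_sinc_le_one _
    · refine Eventually.of_forall fun ω => ?_
      by_cases hω : ω = 0
      · subst hω
        simp only [zero_mul, Real.sinc_zero, mem_singleton_iff, indicator_of_mem, Pi.one_apply]
        exact tendsto_const_nhds
      · rw [indicator_of_notMem (by simpa using hω)]
        refine squeeze_zero_norm' (a := fun R => |ω|⁻¹ * R⁻¹) ?_ ?_
        · filter_upwards [eventually_gt_atTop (0 : ℝ)] with R hR
          rw [Real.norm_eq_abs]
          calc |Real.sinc (ω * R)| ≤ |ω * R|⁻¹ := abs_sinc_le_inv_abs (mul_ne_zero hω hR.ne')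
            _ = |ω|⁻¹ * R⁻¹ := by rw [abs_mul, abs_of_pos hR, mul_inv]
        · have : Tendsto (fun R : ℝ => |ω|⁻¹ * R⁻¹) atTop (𝓝 (|ω|⁻¹ * 0)) :=
            tendsto_inv_atTop_zero.const_mul _
          rwa [mul_zero] at this
  rw [integral_indicator_one (measurableSet_singleton 0)] at hlim
  refine hlim.congr' ?_
  filter_upwards [eventually_gt_atTop (0 : ℝ)] with R hR
  exact (cesaro_eq_integral_sinc hC hR).symm

/-- Hence, under a window density, **the Cesàro means of `C` tend to `0`**. -/
theorem tendsto_cesaro_zero_of_window [IsFiniteMeasure σ]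
    (hC : ∀ t : ℝ, C t = ∫ ω, Real.cos (ω * t) ∂σ) {δ : ℝ} {g : ℝ → ℝ} (hδ : 0 < δ)
    (hw : σ.restrict (Ioo (-δ) δ) =
      (volume.restrict (Ioo (-δ) δ)).withDensity fun ω => ENNReal.ofReal (g ω)) :
    Tendsto (fun R : ℝ => R⁻¹ * ∫ t in (0 : ℝ)..R, C t) atTop (𝓝 0) := by
  have h := tendsto_cesaro_atom hC
  rwa [measureReal_def, atom_eq_zero_of_window hδ hw, ENNReal.toReal_zero] at h

/-- **MAZUR HANDLE (refutation shape (a)).** If the Cesàro means of `C` are FREQUENTLY `≥ d > 0`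
(e.g. Mazur's bound `liminf R⁻¹∫₀^R C ≥ ⟨JQ⟩²/⟨QQ⟩ > 0` from a conserved charge `Q` overlapping
the current), then `σ{0} ≥ d`: there is a Drude atom and no window density exists. -/
theorem le_atom_of_frequently_cesaro [IsFiniteMeasure σ]
    (hC : ∀ t : ℝ, C t = ∫ ω, Real.cos (ω * t) ∂σ) {d : ℝ}
    (hfreq : ∃ᶠ R in atTop, d ≤ R⁻¹ * ∫ t in (0 : ℝ)..R, C t) : d ≤ σ.real {0} := by
  by_contra hlt
  push Not at hlt
  have hev : ∀ᶠ R in atTop, R⁻¹ * ∫ t in (0 : ℝ)..R, C t < d :=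
    (tendsto_cesaro_atom hC).eventually (Iio_mem_nhds hlt)
  obtain ⟨R, h1, h2⟩ := (hfreq.and_eventually hev).exists
  exact absurd h2 (not_lt.mpr h1)

/-- Frequently-positive Cesàro means ⇒ no window density (for any `δ > 0` and any candidate `g`). -/
theorem not_window_of_frequently_cesaro [IsFiniteMeasure σ]
    (hC : ∀ t : ℝ, C t = ∫ ω, Real.cos (ω * t) ∂σ) {d : ℝ} (hd : 0 < d)
    (hfreq : ∃ᶠ R in atTop, d ≤ R⁻¹ * ∫ t in (0 : ℝ)..R, C t) {δ : ℝ} {g : ℝ → ℝ} (hδ : 0 < δ) :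
    σ.restrict (Ioo (-δ) δ) ≠
      (volume.restrict (Ioo (-δ) δ)).withDensity fun ω => ENNReal.ofReal (g ω) := by
  intro hw
  have h := le_atom_of_frequently_cesaro hC hfreq
  rw [measureReal_def, atom_eq_zero_of_window hδ hw, ENNReal.toReal_zero] at h
  exact absurd h (not_le.mpr hd)

/-- **DRUDE FLOOR ⇒ NO WITNESS.** A pointwise floor `d ≤ C(t)` for `t ≥ t₀` (`d > 0`) — the
signature of a conserved current component, e.g. the harmonic chain `lam = β = 0` where the total
energy current is conserved (§4) — forces a Drude atom `σ{0} ≥ d`. -/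
theorem le_atom_of_floor [IsFiniteMeasure σ] (hC : ∀ t : ℝ, C t = ∫ ω, Real.cos (ω * t) ∂σ)
    {d t₀ : ℝ} (ht₀ : 0 ≤ t₀) (hfloor : ∀ t : ℝ, t₀ ≤ t → d ≤ C t) : d ≤ σ.real {0} := by
  have hcont : Continuous C := continuous_cosine hC
  set M : ℝ := C 0 with hM
  have hbd : ∀ t, |C t| ≤ M := abs_cosine_le hC
  -- lower bound of the Cesàro mean: R⁻¹∫₀^R C ≥ d - (t₀ (M + |d|)) / R for R > t₀
  have hlow : ∀ R : ℝ, t₀ < R →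
      d - t₀ * (M + |d|) * R⁻¹ ≤ R⁻¹ * ∫ t in (0 : ℝ)..R, C t := by
    intro R hR
    have hRpos : 0 < R := lt_of_le_of_lt ht₀ hR
    have hsplit : ∫ t in (0 : ℝ)..R, C t = (∫ t in (0 : ℝ)..t₀, C t) + ∫ t in t₀..R, C t :=
      (intervalIntegral.integral_add_adjacent_intervals (hcont.intervalIntegrable 0 t₀)
        (hcont.intervalIntegrable t₀ R)).symm
    have h1 : -(t₀ * M) ≤ ∫ t in (0 : ℝ)..t₀, C t := by
      have := intervalIntegral.abs_integral_le_integral_abs (f := C) (a := 0) (b := t₀) (μ := volume) ht₀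
      have h2 : ∫ t in (0 : ℝ)..t₀, |C t| ≤ ∫ _ in (0 : ℝ)..t₀, M :=
        intervalIntegral.integral_mono_on ht₀ (hcont.abs.intervalIntegrable 0 t₀)
          (continuous_const.intervalIntegrable 0 t₀) fun t _ => hbd t
      rw [intervalIntegral.integral_const, smul_eq_mul, sub_zero] at h2
      have := (abs_le.mp (this.trans h2)).1
      linarith
    have h3 : (R - t₀) * d ≤ ∫ t in t₀..R, C t := by
      have h4 : ∫ _ in t₀..R, d ≤ ∫ t in t₀..R, C t :=
        intervalIntegral.integral_mono_on hR.le (continuous_const.intervalIntegrable t₀ R)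
          (hcont.intervalIntegrable t₀ R) fun t ht => hfloor t ht.1
      rwa [intervalIntegral.integral_const, smul_eq_mul] at h4
    have h5 : R * d - t₀ * (M + |d|) ≤ ∫ t in (0 : ℝ)..R, C t := by
      rw [hsplit]
      have : t₀ * d ≤ t₀ * |d| := mul_le_mul_of_nonneg_left (le_abs_self d) ht₀
      nlinarith
    have h6 : d - t₀ * (M + |d|) * R⁻¹ = R⁻¹ * (R * d - t₀ * (M + |d|)) := by
      field_simp
    rw [h6]
    exact mul_le_mul_of_nonneg_left h5 (inv_nonneg.mpr hRpos.le)
  -- the lower bound tends to d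
  have hlim : Tendsto (fun R : ℝ => d - t₀ * (M + |d|) * R⁻¹) atTop (𝓝 d) := by
    have : Tendsto (fun R : ℝ => d - t₀ * (M + |d|) * R⁻¹) atTop (𝓝 (d - t₀ * (M + |d|) * 0)) :=
      tendsto_const_nhds.sub (tendsto_inv_atTop_zero.const_mul _)
    rwa [mul_zero, sub_zero] at this
  have hev : ∀ᶠ R in atTop, d - t₀ * (M + |d|) * R⁻¹ ≤ R⁻¹ * ∫ t in (0 : ℝ)..R, C t := by
    filter_upwards [eventually_gt_atTop t₀] with R hR using hlow R hR
  exact le_of_tendsto_of_tendsto hlim (tendsto_cesaro_atom hC) hev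

/-- Drude floor ⇒ no window density (for any `δ > 0` and any candidate `g`). -/
theorem not_window_of_floor [IsFiniteMeasure σ] (hC : ∀ t : ℝ, C t = ∫ ω, Real.cos (ω * t) ∂σ)
    {d t₀ : ℝ} (hd : 0 < d) (ht₀ : 0 ≤ t₀) (hfloor : ∀ t : ℝ, t₀ ≤ t → d ≤ C t)
    {δ : ℝ} {g : ℝ → ℝ} (hδ : 0 < δ) :
    σ.restrict (Ioo (-δ) δ) ≠
      (volume.restrict (Ioo (-δ) δ)).withDensity fun ω => ENNReal.ofReal (g ω) := by
  intro hw
  have h := le_atom_of_floor hC ht₀ hfloor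
  rw [measureReal_def, atom_eq_zero_of_window hδ hw, ENNReal.toReal_zero] at h
  exact absurd h (not_le.mpr hd)

/-- A WINDOW CARRIES POSITIVE SPECTRAL MASS: `g` continuous at `0` with `g 0 > 0` gives
`σ((−δ, δ)) > 0` — so a witness has `C(0) = σ(ℝ) > 0` (the conclusion is never met by `C ≡ 0`). -/
theorem measure_window_pos {δ : ℝ} {g : ℝ → ℝ} (hδ : 0 < δ) (hg : ContinuousOn g (Ioo (-δ) δ))
    (hgpos : 0 < g 0)
    (hw : σ.restrict (Ioo (-δ) δ) =
      (volume.restrict (Ioo (-δ) δ)).withDensity fun ω => ENNReal.ofReal (g ω)) :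
    0 < σ (Ioo (-δ) δ) := by
  have h0 : (0 : ℝ) ∈ Ioo (-δ) δ := ⟨by linarith, hδ⟩
  -- continuity at 0: g > g 0 / 2 on a small interval
  have hca : ContinuousAt g 0 := hg.continuousAt (Ioo_mem_nhds h0.1 h0.2)
  have hev : ∀ᶠ ω in 𝓝 (0 : ℝ), g 0 / 2 < g ω :=
    hca.eventually (Ioi_mem_nhds (by linarith : g 0 / 2 < g 0))
  obtain ⟨ε, hε, hball⟩ := Metric.eventually_nhds_iff.1 hev
  set η : ℝ := min (ε / 2) (δ / 2) with hη
  have hηpos : 0 < η := by positivity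
  have hηε : η < ε := lt_of_le_of_lt (min_le_left _ _) (by linarith)
  have hηδ : η < δ := lt_of_le_of_lt (min_le_right _ _) (by linarith)
  have hsub : Ioo (-η) η ⊆ Ioo (-δ) δ := Ioo_subset_Ioo (by linarith) hηδ.le
  have hlow : ∀ ω ∈ Ioo (-η) η, ENNReal.ofReal (g 0 / 2) ≤ ENNReal.ofReal (g ω) := by
    intro ω hω
    refine ENNReal.ofReal_le_ofReal (le_of_lt (hball ?_))
    rw [Real.dist_eq, sub_zero, abs_lt]
    exact ⟨by linarith [hω.1], by linarith [hω.2]⟩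
  have h1 : σ (Ioo (-η) η) = σ.restrict (Ioo (-δ) δ) (Ioo (-η) η) := by
    rw [Measure.restrict_apply measurableSet_Ioo, inter_eq_left.mpr hsub]
  have h2 : ENNReal.ofReal (g 0 / 2) * volume (Ioo (-η) η) ≤ σ (Ioo (-η) η) := by
    rw [h1, hw, withDensity_apply _ measurableSet_Ioo, Measure.restrict_restrict measurableSet_Ioo,
      inter_eq_left.mpr hsub, ← setLIntegral_const]
    exact setLIntegral_mono' measurableSet_Ioo fun ω hω => hlow ω hω
  have h3 : 0 < ENNReal.ofReal (g 0 / 2) * volume (Ioo (-η) η) := by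
    rw [Real.volume_Ioo]
    refine ENNReal.mul_pos (ENNReal.ofReal_pos.mpr (by linarith)).ne' (ENNReal.ofReal_pos.mpr (by linarith)).ne'
  exact lt_of_lt_of_le (lt_of_lt_of_le h3 h2) (measure_mono hsub)

/-- Hence a CONSERVED correlation `C(t) = C(0)` (no sign hypothesis) admits no window density: either
`C 0 > 0` (Drude floor) or `C 0 = σ(ℝ) = 0`, contradicting the positive window mass. -/
theorem not_window_of_conserved₀ [IsFiniteMeasure σ] (hC : ∀ t : ℝ, C t = ∫ ω, Real.cos (ω * t) ∂σ)
    (hcons : ∀ t, C t = C 0) {δ : ℝ} {g : ℝ → ℝ} (hδ : 0 < δ) (hg : ContinuousOn g (Ioo (-δ) δ))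
    (hgpos : 0 < g 0) :
    σ.restrict (Ioo (-δ) δ) ≠
      (volume.restrict (Ioo (-δ) δ)).withDensity fun ω => ENNReal.ofReal (g ω) := by
  intro hw
  rcases lt_or_ge 0 (C 0) with hpos | hle
  · exact not_window_of_floor hC hpos le_rfl (fun t _ => (hcons t).ge) hδ hw
  · have h0 : σ.real univ = 0 := le_antisymm (by rwa [← cosine_zero hC]) measureReal_nonneg
    have huniv : σ univ = 0 := (measureReal_eq_zero_iff (measure_ne_top σ _)).1 h0
    have := measure_window_pos hδ hg hgpos hw
    exact absurd (measure_mono_null (subset_univ _) huniv) this.ne'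

end CosineTransform

/-! ### Consequences for a spectral witness -/

/-- Every spectral witness has NO DRUDE WEIGHT and Cesàro-vanishing correlations: the formal
content of "the atom is dissolved". -/
theorem SpectralWitness.cesaro_zero {ω₂ lam β γ T : ℝ} (h : SpectralWitness ω₂ lam β γ T) :
    ∃ (μT : Measure ChainConfig) (D : InfiniteChainDynamics (pinnedChain ω₂ lam β γ)),
      (pinnedChain ω₂ lam β γ).IsChainGibbsMeasure T μT ∧ D.PreservesMeasure μT ∧
        Continuous (D.currentCorrelation μT) ∧
          (∀ t, |D.currentCorrelation μT t| ≤ D.currentCorrelation μT 0) ∧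
            Tendsto (fun R : ℝ => R⁻¹ * ∫ t in (0 : ℝ)..R, D.currentCorrelation μT t) atTop (𝓝 0) := by
  obtain ⟨μT, D, hG, hP, -, σ, hσ, hC, δ, g, hδ, -, -, -, hw⟩ := h
  exact ⟨μT, D, hG, hP, continuous_cosine hC, abs_cosine_le hC, tendsto_cesaro_zero_of_window hC hδ hw⟩

/-! ## §3 Load-bearing analysis of the parameters and clauses -/

/-! ### §3a The temperature guard `0 < T` is maximal (and cannot be dropped) -/

/-- A spectral witness forces `0 < T` (no DLR state of `pinnedChain` at `T ≤ 0`: the Gibbs kernel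
is the junk measure `0`; tree lemma `isChainGibbsMeasure_pinnedChain_temp_pos`). -/
theorem SpectralWitness.temp_pos {ω₂ lam β γ T : ℝ} (hω : 0 ≤ ω₂) (hl : 0 ≤ lam) (hβ : 0 ≤ β)
    (h : SpectralWitness ω₂ lam β γ T) : 0 < T := by
  obtain ⟨μT, _, hG, -⟩ := h
  exact isChainGibbsMeasure_pinnedChain_temp_pos hω hl hβ hG

/-- The crux with the guard `0 < T` DROPPED from the conclusion. -/
def DrudeDissolutionWithoutTempPos : Prop :=
  ∀ ω₂ lam β γ : ℝ, 0 < ω₂ → 0 < lam → 0 < β → 0 < γ →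
    ∃ T₀ : ℝ, 0 < T₀ ∧ ∀ T : ℝ, T < T₀ → SpectralWitness ω₂ lam β γ T

/-- **ANY PROOF MUST USE `0 < T`**: without it the statement is false (already at `T = 0`, for
every admissible parameter point). Junk-flavoured but exact: the witness set is empty at `T ≤ 0`. -/
theorem drudeDissolution_false_without_temp_pos : ¬ DrudeDissolutionWithoutTempPos := by
  intro h
  obtain ⟨T₀, hT₀, hW⟩ := h 1 1 1 1 one_pos one_pos one_pos one_pos
  have := (hW 0 hT₀).temp_pos zero_le_one zero_le_one zero_le_one
  exact lt_irrefl 0 this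

/-! ### §3b The bath coupling `γ` is decoration -/

/-- `γ` enters no infinite-chain object: witnesses transport between `γ` and `γ'` verbatim
(tree: `OscillatorChain.transportUV`). -/
theorem SpectralWitness.of_gamma {ω₂ lam β T : ℝ} (γ γ' : ℝ) (h : SpectralWitness ω₂ lam β γ T) :
    SpectralWitness ω₂ lam β γ' T := by
  have hU : (pinnedChain ω₂ lam β γ).U = (pinnedChain ω₂ lam β γ').U := rfl
  have hV : (pinnedChain ω₂ lam β γ).V = (pinnedChain ω₂ lam β γ').V := rfl
  obtain ⟨μT, D, hG, hP, hAC, σ, hσ, hC, rest⟩ := h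
  refine ⟨μT, OscillatorChain.transportUV hU hV D,
    (OscillatorChain.isChainGibbsMeasure_iff_of_UV hU hV T μT).1 hG,
    (OscillatorChain.preservesMeasure_transportUV_iff hU hV D μT).2 hP,
    fun t => (OscillatorChain.hasAbsConvergentCorrelation_transportUV_iff hU hV D μT t).2 (hAC t),
    σ, hσ, fun t => ?_, rest⟩
  rw [OscillatorChain.currentCorrelation_transportUV]
  exact hC t

theorem spectralWitness_gamma_irrel (ω₂ lam β γ γ' T : ℝ) :
    SpectralWitness ω₂ lam β γ T ↔ SpectralWitness ω₂ lam β γ' T :=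
  ⟨SpectralWitness.of_gamma γ γ', SpectralWitness.of_gamma γ' γ⟩

/-- **`0 < γ` IS UNNECESSARY**: the crux is equivalent to its `γ = 1` slice with the hypothesis
`0 < γ` deleted — a statement about the CLOSED infinite chain `(ω₂, lam, β)` only. -/
theorem drudeDissolution_iff_gamma_free :
    DrudeDissolution ↔ ∀ ω₂ lam β : ℝ, 0 < ω₂ → 0 < lam → 0 < β →
      ∃ T₀ : ℝ, 0 < T₀ ∧ ∀ T : ℝ, 0 < T → T < T₀ → SpectralWitness ω₂ lam β 1 T := by
  rw [drudeDissolution_iff]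
  constructor
  · intro h ω₂ lam β hω hl hβ
    exact h ω₂ lam β 1 hω hl hβ one_pos
  · intro h ω₂ lam β γ hω hl hβ _
    obtain ⟨T₀, hT₀, hW⟩ := h ω₂ lam β hω hl hβ
    exact ⟨T₀, hT₀, fun T hT hlt => (hW T hT hlt).of_gamma 1 γ⟩

/-! ### §3c Junk inhabitants: what the Gibbs clause and `0 < g 0` exclude -/

/-- **LAX WITNESSES ARE TRIVIAL**: weaken "Gibbs" to "probability measure" and `0 < g 0` to
`0 ≤ g 0` (the temperature then no longer occurs), and the conclusion holds at EVERY `(ω₂, lam, β, γ)` by junk — Dirac mass at rest,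
rest dynamics (tree `OscillatorChain.restDynamics`), `C ≡ 0`, `σ = 0`, `g = 0`. Both clauses are
therefore load-bearing for non-triviality; neither is removable by the planner. -/
theorem laxSpectralWitness_all (ω₂ lam β γ : ℝ) :
    ∃ (μ : Measure ChainConfig) (D : InfiniteChainDynamics (pinnedChain ω₂ lam β γ)),
      IsProbabilityMeasure μ ∧ D.PreservesMeasure μ ∧ (∀ t : ℝ, D.HasAbsConvergentCorrelation μ t) ∧
        ∃ σ : Measure ℝ, IsFiniteMeasure σ ∧ (∀ t : ℝ, D.currentCorrelation μ t = ∫ ω, Real.cos (ω * t) ∂σ) ∧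
          ∃ (δ : ℝ) (g : ℝ → ℝ), 0 < δ ∧ ContinuousOn g (Ioo (-δ) δ) ∧ (∀ ω ∈ Ioo (-δ) δ, 0 ≤ g ω) ∧
            0 ≤ g 0 ∧ σ.restrict (Ioo (-δ) δ) =
              (volume.restrict (Ioo (-δ) δ)).withDensity fun ω => ENNReal.ofReal (g ω) := by
  have hU := deriv_U_pinnedChain_zero ω₂ lam β γ
  refine ⟨Measure.dirac restConfig, (pinnedChain ω₂ lam β γ).restDynamics hU, inferInstance,
    (pinnedChain ω₂ lam β γ).restDynamics_preserves_dirac hU,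
    (pinnedChain ω₂ lam β γ).hasAbsConvergentCorrelation_restDynamics hU, 0, inferInstance,
    fun t => ?_, 1, fun _ => 0, one_pos, continuousOn_const, fun _ _ => le_rfl, le_rfl, ?_⟩
  · rw [OscillatorChain.currentCorrelation_restDynamics, integral_zero_measure]
  · simp only [Measure.restrict_zero, ENNReal.ofReal_zero]
    rw [show (fun _ : ℝ => (0 : ℝ≥0∞)) = 0 from rfl, withDensity_zero]

/-- **DLR STATES CHARGE NO MOMENTUM HYPERPLANE**: `μ {σ | p₀(σ) = v} = 0` (the kernel in volume
`{0}` is absolutely continuous w.r.t. Lebesgue in `(q₀, p₀)`, and a line has plane measure `0`).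
Companion of the tree lemma `IsChainGibbsMeasure.measure_coord_eq_zero` (which is about the point
`σ 0 = v`). -/
theorem measure_momentum_eq_zero {P : OscillatorChain} {T : ℝ} {μ : Measure ChainConfig}
    (h : P.IsChainGibbsMeasure T μ) (v : ℝ) : μ {σ | (σ 0).2 = v} = 0 := by
  obtain ⟨-, hDLR⟩ := h
  have hA : MeasurableSet {σ : ChainConfig | (σ 0).2 = v} :=
    measurableSet_eq_fun (measurable_snd.comp (measurable_pi_apply 0)) measurable_const
  rw [← hDLR {0} _ hA]
  have hker : ∀ η : ChainConfig, P.chainSpecification T {0} η {σ | (σ 0).2 = v} = 0 := by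
    intro η
    show gibbsSpecOfPotential volume P.chainPotential OscillatorChain.chainSupp T⁻¹ {0} η _ = 0
    simp only [gibbsSpecOfPotential]
    refine tilted_absolutelyContinuous _ _ ?_
    rw [Measure.map_apply (measurable_glueWith _ η) hA]
    have hpre : (fun ζ : (({0} : Finset ℤ)) → ℝ × ℝ => glueWith {0} ζ η) ⁻¹' {σ | (σ 0).2 = v} =
        Set.pi univ (fun _ => {w : ℝ × ℝ | w.2 = v}) := by
      ext ζ
      simp only [mem_preimage, mem_setOf_eq, mem_univ_pi]
      constructor
      · intro hζ i
        obtain ⟨i, hi⟩ := i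
        have hi0 : i = 0 := Finset.mem_singleton.mp hi
        subst hi0
        rwa [glueWith_apply_mem _ _ _ hi] at hζ
      · intro hζ
        rw [glueWith_apply_mem _ _ _ (Finset.mem_singleton_self 0)]
        exact hζ ⟨0, Finset.mem_singleton_self 0⟩
    rw [hpre, Measure.pi_pi]
    apply Finset.prod_eq_zero (Finset.mem_univ ⟨0, Finset.mem_singleton_self 0⟩)
    rw [show ({w : ℝ × ℝ | w.2 = v}) = (univ : Set ℝ) ×ˢ ({v} : Set ℝ) by
        ext ⟨a, b⟩; simp,
      Measure.volume_eq_prod, Measure.prod_prod]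
    simp
  simp_rw [hker]
  exact lintegral_zero

/-- **THE IDENTITY FLOW IS EXCLUDED** by `PreservesMeasure` + the Gibbs clause: if every carrier
point were fixed by the flow, every carrier point would be an equilibrium, so `p₀ = 0` on the
carrier — a `μ`-null event for a DLR state, contradicting `μ(carrier) = 1`. (The route-review
note's informal claim, certified; so `∃ D` is not junk-satisfiable by `flow t = id`.) -/
theorem not_identity_flow {P : OscillatorChain} {T : ℝ} {μ : Measure ChainConfig}
    (hG : P.IsChainGibbsMeasure T μ) (D : InfiniteChainDynamics P) (hP : D.PreservesMeasure μ) :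
    ¬ ∀ σ ∈ D.carrier, ∀ t : ℝ, D.flow t σ = σ := by
  intro hid
  have hsub : D.carrier ⊆ {σ | (σ 0).2 = 0} := by
    intro σ hσ
    have hsol : P.IsSolution fun _ : ℝ => σ := by
      have := D.isSolution σ hσ
      simp only [hid σ hσ] at this
      exact this
    exact OscillatorChain.momenta_zero_of_const_isSolution hsol 0
  have h0 : μ {σ | (σ 0).2 = 0} = 0 := measure_momentum_eq_zero hG 0
  have hae : ∀ᵐ σ ∂μ, σ ∈ ({σ | (σ 0).2 = 0} : Set ChainConfig) := hP.1.mono fun σ hσ => hsub hσ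
  have hprob := hG.isProbabilityMeasure
  rw [ae_iff] at hae
  have : μ univ = 0 := by
    have hsplit : (univ : Set ChainConfig) = {σ | (σ 0).2 = 0} ∪ {σ | ¬ σ ∈ ({σ | (σ 0).2 = 0} : Set ChainConfig)} := by
      ext σ; simp only [mem_univ, mem_union, mem_setOf_eq, true_iff]; exact em _
    rw [hsplit]
    exact measure_union_null h0 hae
  rw [measure_univ] at this
  exact one_ne_zero this

/-! ### §3d LOW TEMPERATURE IS WEAK ANHARMONICITY: the scaling conjugacy of spectral witnesses

The amplitude dilation `σ ↦ s • σ` conjugates the `(lam s², β s²)` chain at `T` to the `(lam, β)`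
chain at `s²T` (tree: `InfiniteChainGibbsScaling`, `InfiniteChainAmplitudeScaling`; no time
change, currents `j ↦ s² j`, `C ↦ s⁴ C`). The current spectral measure transports as `σ ↦ s⁴ σ`,
the window is unchanged and the density becomes `s⁴ g` — so the WITNESS PREDICATE IS INVARIANT. -/

/-- Transport of a spectral witness along the dilation (general `s ≠ 0`). -/
theorem SpectralWitness.transport {ω₂ lam β γ T s : ℝ} (hs : s ≠ 0)
    (h : SpectralWitness ω₂ (lam * s ^ 2) (β * s ^ 2) γ T) :
    SpectralWitness ω₂ lam β γ (s ^ 2 * T) := by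
  obtain ⟨μ, D, hG, hP, hAC, σ, hσ, hC, δ, g, hδ, hg, hg0, hgpos, hw⟩ := h
  have hs4 : (0 : ℝ) < s ^ 4 := by positivity
  refine ⟨μ.map (dilEquiv hs), smulDynamics ω₂ lam β γ hs D,
    isChainGibbsMeasure_map_dil ω₂ lam β γ hs hG, preservesMeasure_smulDynamics ω₂ lam β γ hs hP,
    fun t => (hasAbsConvergentCorrelation_smulDynamics_iff ω₂ lam β γ hs D μ t).2 (hAC t),
    ENNReal.ofReal (s ^ 4) • σ, (by haveI := hσ; exact Measure.smul_finite σ ENNReal.ofReal_ne_top),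
    fun t => ?_, δ, fun ω => s ^ 4 * g ω, hδ,
    continuousOn_const.mul hg, fun ω hω => mul_nonneg hs4.le (hg0 ω hω), mul_pos hs4 hgpos, ?_⟩
  · rw [currentCorrelation_smulDynamics, integral_smul_measure, ENNReal.toReal_ofReal hs4.le,
      smul_eq_mul, hC t]
  · rw [Measure.restrict_smul, hw]
    have : (fun ω => ENNReal.ofReal (s ^ 4 * g ω)) =
        ENNReal.ofReal (s ^ 4) • fun ω => ENNReal.ofReal (g ω) := by
      funext ω
      simp only [Pi.smul_apply, smul_eq_mul]
      rw [ENNReal.ofReal_mul hs4.le]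
    rw [this, withDensity_smul' _ _ ENNReal.ofReal_ne_top]

/-- **SPECTRAL WITNESS AT `T` ⇔ UNIT-TEMPERATURE WITNESS OF THE RESCALED CHAIN** (`T > 0`). -/
theorem spectralWitness_iff_unit_temp {ω₂ lam β γ T : ℝ} (hT : 0 < T) :
    SpectralWitness ω₂ lam β γ T ↔ SpectralWitness ω₂ (lam * T) (β * T) γ 1 := by
  have hs : Real.sqrt T ≠ 0 := (Real.sqrt_pos.mpr hT).ne'
  have hs2 : Real.sqrt T ^ 2 = T := Real.sq_sqrt hT.le
  constructor
  · intro h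
    have key := SpectralWitness.transport (ω₂ := ω₂) (lam := lam * T) (β := β * T) (γ := γ) (T := T)
      (inv_ne_zero hs)
    have e1 : lam * T * (Real.sqrt T)⁻¹ ^ 2 = lam := by rw [inv_pow, hs2]; field_simp
    have e2 : β * T * (Real.sqrt T)⁻¹ ^ 2 = β := by rw [inv_pow, hs2]; field_simp
    have e3 : (Real.sqrt T)⁻¹ ^ 2 * T = 1 := by rw [inv_pow, hs2]; field_simp
    rw [e1, e2, e3] at key
    exact key h
  · intro h
    have key := SpectralWitness.transport (ω₂ := ω₂) (lam := lam) (β := β) (γ := γ) (T := 1) hs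
    rw [hs2, mul_one] at key
    exact key h

/-- CONJUGACY CLASSES: a witness at `(lam, β; T)` gives one at `(lam T/S, β T/S; S)` for every
`S > 0` — the witness set in `(lam, β, T)`-space is a union of the curves `{(a/S, b/S, S)}`. -/
theorem SpectralWitness.conjugacyClass {ω₂ lam β γ T S : ℝ} (hT : 0 < T) (hS : 0 < S)
    (h : SpectralWitness ω₂ lam β γ T) : SpectralWitness ω₂ (lam * T / S) (β * T / S) γ S := by
  rw [spectralWitness_iff_unit_temp hS]
  rw [spectralWitness_iff_unit_temp hT] at h
  have e1 : lam * T / S * S = lam * T := div_mul_cancel₀ _ hS.ne'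
  have e2 : β * T / S * S = β * T := div_mul_cancel₀ _ hS.ne'
  rw [e1, e2]
  exact h

/-- **WEAK-ANHARMONICITY FORM OF THE CRUX.** `DrudeDissolution` is EXACTLY the statement that, at
temperature `1`, every coupling RAY `ε ↦ (a ε, b ε)` (`a, b > 0`) of pinned doubly-quartic chains
carries spectral witnesses on an initial segment `ε ∈ (0, ε₀)`: the dissolution of the harmonic
Drude atom at SMALL BUT POSITIVE anharmonicity, uniformly in nothing. The low-temperature limit of
the conjunct's fixed chain and the weak-coupling limit at fixed temperature are the same problem. -/
theorem drudeDissolution_iff_weak_anharmonicity :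
    DrudeDissolution ↔ ∀ ω₂ a b : ℝ, 0 < ω₂ → 0 < a → 0 < b →
      ∃ ε₀ : ℝ, 0 < ε₀ ∧ ∀ ε : ℝ, 0 < ε → ε < ε₀ → SpectralWitness ω₂ (a * ε) (b * ε) 1 1 := by
  rw [drudeDissolution_iff_gamma_free]
  refine forall₃_congr fun ω₂ a b => ?_
  refine imp_congr_right fun _ => imp_congr_right fun _ => imp_congr_right fun _ => ?_
  refine exists_congr fun ε₀ => and_congr_right fun _ => forall_congr' fun ε => ?_
  refine imp_congr_right fun hε => imp_congr_right fun _ => ?_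
  exact spectralWitness_iff_unit_temp hε

/-- **REFUTATION SHAPE.** `¬ DrudeDissolution` iff in SOME direction `(a, b)` of the coupling
quadrant the unit-temperature chains `pinnedChain ω₂ (aε) (bε)` FAIL to have a spectral witness
for a sequence of anharmonicities `ε ↓ 0`: ballistic or singular low-frequency current spectrum
persisting at ARBITRARILY WEAK (but non-zero) anharmonicity. A single bad coupling never suffices. -/
theorem not_drudeDissolution_iff :
    ¬ DrudeDissolution ↔ ∃ ω₂ a b : ℝ, 0 < ω₂ ∧ 0 < a ∧ 0 < b ∧
      ∀ ε₀ : ℝ, 0 < ε₀ → ∃ ε : ℝ, 0 < ε ∧ ε < ε₀ ∧ ¬ SpectralWitness ω₂ (a * ε) (b * ε) 1 1 := by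
  rw [drudeDissolution_iff_weak_anharmonicity]
  push Not
  rfl

/-- Equivalently (germ form at unit temperature): witnesses FREQUENTLY fail as `ε ↓ 0`. -/
theorem not_drudeDissolution_iff_frequently :
    ¬ DrudeDissolution ↔ ∃ ω₂ a b : ℝ, 0 < ω₂ ∧ 0 < a ∧ 0 < b ∧
      ∃ᶠ ε in 𝓝[>] (0 : ℝ), ¬ SpectralWitness ω₂ (a * ε) (b * ε) 1 1 := by
  rw [not_drudeDissolution_iff]
  refine exists₃_congr fun ω₂ a b => ?_
  refine and_congr_right fun _ => and_congr_right fun _ => and_congr_right fun _ => ?_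
  rw [Filter.Frequently, (nhdsGT_basis (0 : ℝ)).eventually_iff]
  push Not
  constructor
  · intro h ε₀ hε₀
    obtain ⟨ε, hε, hlt, hn⟩ := h ε₀ hε₀
    exact ⟨ε, ⟨hε, hlt⟩, hn⟩
  · intro h ε₀ hε₀
    obtain ⟨ε, ⟨hε, hlt⟩, hn⟩ := h ε₀ hε₀
    exact ⟨ε, hε, hlt, hn⟩

/-- THRESHOLD NORMALISATION: it suffices to prove the crux with `T₀ = 1` after rescaling the
couplings — `DrudeDissolution ↔ ∀ (ω₂,lam,β) > 0, ∃ c > 0, ∀ T ∈ (0,1), SW ω₂ (lam c) (β c) 1 T`. -/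
theorem drudeDissolution_iff_unit_threshold :
    DrudeDissolution ↔ ∀ ω₂ lam β : ℝ, 0 < ω₂ → 0 < lam → 0 < β →
      ∃ c : ℝ, 0 < c ∧ ∀ T : ℝ, 0 < T → T < 1 → SpectralWitness ω₂ (lam * c) (β * c) 1 T := by
  rw [drudeDissolution_iff_weak_anharmonicity]
  refine forall₃_congr fun ω₂ lam β => ?_
  refine imp_congr_right fun _ => imp_congr_right fun _ => imp_congr_right fun _ => ?_
  constructor
  · rintro ⟨ε₀, hε₀, h⟩
    refine ⟨ε₀, hε₀, fun T hT hT1 => ?_⟩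
    rw [spectralWitness_iff_unit_temp hT]
    have := h (ε₀ * T) (mul_pos hε₀ hT) (by nlinarith)
    rw [show lam * ε₀ * T = lam * (ε₀ * T) by ring, show β * ε₀ * T = β * (ε₀ * T) by ring]
    exact this
  · rintro ⟨c, hc, h⟩
    refine ⟨c, hc, fun ε hε hlt => ?_⟩
    have hT : 0 < ε / c := div_pos hε hc
    have := h (ε / c) hT ((div_lt_one hc).mpr hlt)
    rw [spectralWitness_iff_unit_temp hT] at this
    have e1 : lam * c * (ε / c) = lam * ε := by field_simp
    have e2 : β * c * (ε / c) = β * ε := by field_simp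
    rw [e1, e2] at this
    exact this

/-! ## §4 The harmonic endpoint `lam = β = 0`: why `0 < lam ∧ 0 < β` is load-bearing

At `ε = 0` the weak-anharmonicity form (§3d) degenerates to the pinned HARMONIC chain at unit
temperature, whose total energy current `J = Σ_x j_x` is an exact constant of motion: the local
conservation law `d/dt j_x = k_x − k_{x+1}` below (a pointwise identity along every solution, no
measure, no summability). Formally `C(t) = Σ_x ⟨j_0 · j_x∘φ_t⟩ = ⟨j_0 J⟩ = C(0) > 0` for all `t`
(a DRUDE FLOOR), so by `not_window_of_floor` no spectral witness exists: the Drude ATOM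
`σ_T = C_T(0)·δ_0 + …`. This is Mazur's charge `Q = J` itself; for `lam, β > 0` no local or
quasi-local conserved `Q` odd under momentum reversal with `⟨JQ⟩ ≠ 0` is known (stretch is even
with zero susceptibility; momentum is broken by pinning), which is why the crux resists attack (a). -/

/-- The CURRENT OF THE CURRENT of the pinned harmonic chain:
`k_x = ½[p_x² − (ω₂+1) q_x² + q_x (q_{x−1} + q_{x+1}) − q_{x−1} q_{x+1}]`. -/
def harmonicCurrentFlux (ω₂ : ℝ) (σ : ChainConfig) (x : ℤ) : ℝ :=
  ((σ x).2 ^ 2 - (ω₂ + 1) * (σ x).1 ^ 2 + (σ x).1 * ((σ (x - 1)).1 + (σ (x + 1)).1)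
    - (σ (x - 1)).1 * (σ (x + 1)).1) / 2

/-- **LOCAL CONSERVATION OF THE HARMONIC ENERGY CURRENT.** Along every solution of the pinned
harmonic chain `pinnedChain ω₂ 0 0 γ` (any `ω₂, γ`), `d/dt j_x = k_x − k_{x+1}`: the bond current
is itself a locally conserved density, so `Σ_x j_x` is (formally) a constant of motion — the
Mazur charge behind the harmonic Drude atom. Pure calculus on the equations of motion. -/
theorem hasDerivAt_bondCurrentZ_harmonic {ω₂ γ : ℝ} {c : ℝ → ChainConfig}
    (hc : (pinnedChain ω₂ 0 0 γ).IsSolution c) (x : ℤ) (t : ℝ) :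
    HasDerivAt (fun s => (pinnedChain ω₂ 0 0 γ).bondCurrentZ (c s) x)
      (harmonicCurrentFlux ω₂ (c t) x - harmonicCurrentFlux ω₂ (c t) (x + 1)) t := by
  have hq : ∀ i, HasDerivAt (fun s => (c s i).1) ((c t i).2) t := fun i => (hc i t).1
  have hp : ∀ i, HasDerivAt (fun s => (c s i).2) ((pinnedChain ω₂ 0 0 γ).force (c t) i) t :=
    fun i => (hc i t).2
  have hV : ∀ r, deriv (pinnedChain ω₂ 0 0 γ).V r = r := fun r => by
    rw [(AmplitudeScaling.hasDerivAt_V ω₂ 0 0 γ r).deriv]; ring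
  have hU : ∀ q, deriv (pinnedChain ω₂ 0 0 γ).U q = ω₂ * q := fun q => by
    rw [(AmplitudeScaling.hasDerivAt_U ω₂ 0 0 γ q).deriv]; ring
  have hF : ∀ (σ : ChainConfig) (i : ℤ), (pinnedChain ω₂ 0 0 γ).force σ i =
      -(ω₂ * (σ i).1) + ((σ (i + 1)).1 - (σ i).1) - ((σ i).1 - (σ (i - 1)).1) := fun σ i => by
    rw [OscillatorChain.force_eq, hU, hV, hV]
  have hj : (fun s => (pinnedChain ω₂ 0 0 γ).bondCurrentZ (c s) x) =
      fun s => -(((c s x).2 + (c s (x + 1)).2) / 2 * ((c s (x + 1)).1 - (c s x).1)) := by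
    funext s
    simp only [OscillatorChain.bondCurrentZ, hV]
  rw [hj]
  have h1 := ((hp x).add (hp (x + 1))).div_const 2
  have h2 := (hq (x + 1)).sub (hq x)
  have h3 : HasDerivAt (fun s => -(((c s x).2 + (c s (x + 1)).2) / 2 * ((c s (x + 1)).1 - (c s x).1)))
      (-((((pinnedChain ω₂ 0 0 γ).force (c t) x + (pinnedChain ω₂ 0 0 γ).force (c t) (x + 1)) / 2) *
          ((c t (x + 1)).1 - (c t x).1) +
        ((c t x).2 + (c t (x + 1)).2) / 2 * ((c t (x + 1)).2 - (c t x).2))) t :=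
    (h1.mul h2).neg
  refine h3.congr_deriv ?_
  simp only [hF, harmonicCurrentFlux, add_sub_cancel_right]
  ring

/-- The abstract end of the harmonic obstruction: a CONSERVED correlation `C(t) = C(0) > 0`
(Drude floor with `t₀ = 0`) admits no window density — so at `lam = β = 0` every `(μ, D)` whose
summed correlation is conserved (the physical ones) fails the conclusion. -/
theorem not_window_of_conserved {σ : Measure ℝ} [IsFiniteMeasure σ] {C : ℝ → ℝ}
    (hC : ∀ t : ℝ, C t = ∫ ω, Real.cos (ω * t) ∂σ) (hcons : ∀ t, C t = C 0) (h0 : 0 < C 0)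
    {δ : ℝ} {g : ℝ → ℝ} (hδ : 0 < δ) :
    σ.restrict (Ioo (-δ) δ) ≠
      (volume.restrict (Ioo (-δ) δ)).withDensity fun ω => ENNReal.ofReal (g ω) :=
  not_window_of_floor hC h0 le_rfl (fun t _ => (hcons t).ge) hδ

/-- NEAR-MISS (not closed): **the harmonic chain has no spectral witness** — what
`drudeDissolution_false_without_anharmonicity` would need for ALL DLR states and ALL preserving
dynamics. Obstructions to a Lean proof, in order: (i) `C(t) = C(0)` needs the exchange
`Σ_x ∫ j_0 ∫₀^t (k_x − k_{x+1})∘φ_s ds dμ = ∫₀^t Σ_x (K_x(s) − K_{x+1}(s)) ds = 0`, i.e. JOINT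
measurability of `(s, σ) ↦ φ_s σ` (not a field of `InfiniteChainDynamics`) and summability of
`x ↦ sup_{s ≤ t} ∫ |j_0| |k_x∘φ_s| dμ` (a locality / finite-speed estimate for the witness's own
`D`, which is only known to solve the equations on its carrier); (ii) the DLR class contains
non-tempered Gaussian states (`μ_h`, `h` an exponentially growing `(−Δ+ω₂)`-harmonic profile,
Georgii Ch. 13) for which even `C(0) < ∞` is unclear. The physical content is not in doubt
(`HarmonicChainBallisticFlux_holds` certifies the open-chain twin `κ_N ∝ N`). Recorded with
`sorry` as the one missing brick of the load-bearing analysis; provers should read it as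
"any proof of the crux must use `lam > 0 ∨ β > 0` quantitatively (the window `δ(ε) → 0`)". -/
theorem harmonic_no_spectralWitness (ω₂ γ T : ℝ) (hω : 0 < ω₂) (hT : 0 < T) :
    ¬ SpectralWitness ω₂ 0 0 γ T := by
  sorry

/-! ## §5 A natural strengthening that FAILS in pure analysis: window density ⇏ `C ∈ L¹` -/

section WindowNotL1
open Complex
open scoped Real

/-- Gaussian cosine transform: `∫ cos(ω t) e^{-ω²/2} dω = √(2π) e^{-t²/2}`. -/
theorem integral_cos_mul_gaussian (t : ℝ) :
    ∫ ω : ℝ, Real.cos (ω * t) * Real.exp (-(ω ^ 2 / 2)) =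
      Real.sqrt (2 * π) * Real.exp (-(t ^ 2 / 2)) := by
  have hb : (0 : ℝ) < ((1 / 2 : ℂ)).re := by norm_num
  have key := fourierIntegral_gaussian hb (t : ℂ)
  -- integrability of the complex integrand
  have hint : Integrable (fun x : ℝ => cexp (I * (t : ℂ) * x) * cexp (-(1 / 2 : ℂ) * (x : ℂ) ^ 2)) := by
    have h := integrable_cexp_quadratic hb (I * (t : ℂ)) 0
    refine h.congr (Eventually.of_forall fun x => ?_)
    simp only
    rw [← Complex.exp_add]
    congr 1
    ring
  -- real parts of the integrand
  have hre : ∀ x : ℝ, (cexp (I * (t : ℂ) * x) * cexp (-(1 / 2 : ℂ) * (x : ℂ) ^ 2)).re =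
      Real.cos (x * t) * Real.exp (-(x ^ 2 / 2)) := by
    intro x
    have h1 : I * (t : ℂ) * x = ((t * x : ℝ) : ℂ) * I := by push_cast; ring
    have h2 : -(1 / 2 : ℂ) * (x : ℂ) ^ 2 = ((-(x ^ 2 / 2) : ℝ) : ℂ) := by push_cast; ring
    rw [h1, h2, Complex.exp_mul_I, ← Complex.ofReal_exp, ← Complex.ofReal_cos, ← Complex.ofReal_sin]
    simp only [Complex.mul_re, Complex.add_re, Complex.ofReal_re, Complex.mul_im, Complex.add_im,
      Complex.ofReal_im, Complex.I_re, Complex.I_im]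
    rw [mul_comm x t]
    ring
  have hlhs : (∫ x : ℝ, cexp (I * (t : ℂ) * x) * cexp (-(1 / 2 : ℂ) * (x : ℂ) ^ 2)).re =
      ∫ ω : ℝ, Real.cos (ω * t) * Real.exp (-(ω ^ 2 / 2)) := by
    have h := integral_re hint
    simp only [RCLike.re_to_complex] at h
    rw [← h]
    exact integral_congr_ae (Eventually.of_forall hre)
  have hrhs : ((π / (1 / 2 : ℂ)) ^ (1 / 2 : ℂ) * cexp (-(t : ℂ) ^ 2 / (4 * (1 / 2 : ℂ)))).re =
      Real.sqrt (2 * π) * Real.exp (-(t ^ 2 / 2)) := by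
    have h2 : (π / (1 / 2 : ℂ)) ^ (1 / 2 : ℂ) = ((Real.sqrt (2 * π) : ℝ) : ℂ) := by
      rw [Real.sqrt_eq_rpow, ofReal_cpow (by positivity) (1 / 2)]
      congr 1
      · push_cast; ring
      · push_cast; ring
    have h3 : cexp (-(t : ℂ) ^ 2 / (4 * (1 / 2 : ℂ))) = ((Real.exp (-(t ^ 2 / 2)) : ℝ) : ℂ) := by
      rw [Complex.ofReal_exp]
      congr 1
      push_cast; ring
    rw [h2, h3, ← Complex.ofReal_mul, Complex.ofReal_re]
  have := congrArg Complex.re key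
  rw [hlhs, hrhs] at this
  exact this

/-- The Gaussian `ω ↦ e^{-ω²/2}` is integrable. -/
theorem integrable_gaussian : Integrable (fun ω : ℝ => Real.exp (-(ω ^ 2 / 2))) := by
  refine (integrable_exp_neg_mul_sq (by norm_num : (0 : ℝ) < 1 / 2)).congr ?_
  exact Eventually.of_forall fun x => by simp only; congr 1; ring

/-- `t ↦ cos (2t)` is not integrable on `(0, ∞)`. -/
theorem not_integrableOn_cos_two_mul : ¬ IntegrableOn (fun t : ℝ => Real.cos (2 * t)) (Ioi 0) := by
  intro hB
  have hBabs : IntegrableOn (fun t : ℝ => |Real.cos (2 * t)|) (Ioi 0) := hB.abs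
  set M : ℝ := ∫ t in Ioi (0 : ℝ), |Real.cos (2 * t)| with hM
  have hM0 : 0 ≤ M := setIntegral_nonneg measurableSet_Ioi fun t _ => abs_nonneg _
  -- lower bound of the truncated integrals
  have hlow : ∀ R : ℝ, 0 ≤ R → R / 2 - 1 / 8 ≤ M := by
    intro R hR
    have hcont : Continuous fun t : ℝ => Real.cos (2 * t) :=
      Real.continuous_cos.comp (continuous_const.mul continuous_id)
    -- (1) ∫₀^R cos²(2t) = (cos(2R) sin(2R) + 2R)/4
    have h1 : ∫ t in (0 : ℝ)..R, Real.cos (2 * t) ^ 2 =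
        2⁻¹ * ((Real.cos (2 * R) * Real.sin (2 * R) - Real.cos 0 * Real.sin 0 + 2 * R - 0) / 2) := by
      have := intervalIntegral.integral_comp_mul_left (a := 0) (b := R) (fun u => Real.cos u ^ 2)
        (two_ne_zero)
      rw [this, integral_cos_sq, smul_eq_mul, mul_zero]
    have h2 : R / 2 - 1 / 8 ≤ ∫ t in (0 : ℝ)..R, Real.cos (2 * t) ^ 2 := by
      rw [h1, Real.cos_zero, Real.sin_zero]
      nlinarith [Real.cos_sq_add_sin_sq (2 * R), sq_nonneg (Real.cos (2 * R) + Real.sin (2 * R))]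
    -- (2) cos² ≤ |cos|
    have h3 : ∫ t in (0 : ℝ)..R, Real.cos (2 * t) ^ 2 ≤ ∫ t in (0 : ℝ)..R, |Real.cos (2 * t)| := by
      refine intervalIntegral.integral_mono_on hR ((hcont.pow 2).intervalIntegrable 0 R)
        (hcont.abs.intervalIntegrable 0 R) fun t _ => ?_
      rw [← sq_abs]
      exact pow_le_of_le_one (abs_nonneg _) (Real.abs_cos_le_one _) two_ne_zero
    -- (3) truncated ≤ full
    have h4 : ∫ t in (0 : ℝ)..R, |Real.cos (2 * t)| ≤ M := by
      rw [intervalIntegral.integral_of_le hR, hM]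
      refine setIntegral_mono_set hBabs (Eventually.of_forall fun t => abs_nonneg _)
        (Eventually.of_forall Ioc_subset_Ioi_self)
    linarith
  have := hlow (2 * M + 1) (by linarith)
  linarith

/-- **A WINDOW DENSITY DOES NOT GIVE `C ∈ L¹`** (the crux's conclusion is strictly weaker than the
`HasGreenKubo` clause of `FourierGreenKubo`, stmt-0703, already at the level of pure analysis):
`σ = e^{-ω²/2}dω + δ_2` is finite, `C(t) = ∫cos(ωt)dσ = √(2π)e^{-t²/2} + cos 2t` has the perfect
window `(−1, 1)` with density `e^{-ω²/2}`, `g(0) = 1`, yet `C ∉ L¹(0, ∞)` (an atom of `σ` AWAY from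
`0` = an undamped oscillation of `C`, harmless for the Abel limit `π g(0)`). -/
theorem exists_window_not_integrable :
    ∃ (σ : Measure ℝ) (C : ℝ → ℝ), IsFiniteMeasure σ ∧ (∀ t : ℝ, C t = ∫ ω, Real.cos (ω * t) ∂σ) ∧
      (∃ (δ : ℝ) (g : ℝ → ℝ), 0 < δ ∧ ContinuousOn g (Ioo (-δ) δ) ∧ (∀ ω ∈ Ioo (-δ) δ, 0 ≤ g ω) ∧
        0 < g 0 ∧ σ.restrict (Ioo (-δ) δ) =
          (volume.restrict (Ioo (-δ) δ)).withDensity fun ω => ENNReal.ofReal (g ω)) ∧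
      ¬ IntegrableOn C (Ioi 0) := by
  set gauss : ℝ → ℝ := fun ω => Real.exp (-(ω ^ 2 / 2)) with hgauss
  have hgc : Continuous gauss := by
    rw [hgauss]; fun_prop
  have hgm : Measurable fun ω => ENNReal.ofReal (gauss ω) := ENNReal.measurable_ofReal.comp hgc.measurable
  set σ₁ : Measure ℝ := volume.withDensity fun ω => ENNReal.ofReal (gauss ω) with hσ₁
  haveI hfin₁ : IsFiniteMeasure σ₁ := isFiniteMeasure_withDensity_ofReal integrable_gaussian.hasFiniteIntegral
  set C : ℝ → ℝ := fun t => Real.sqrt (2 * π) * Real.exp (-(t ^ 2 / 2)) + Real.cos (2 * t) with hCdef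
  have hcosint : ∀ (ν : Measure ℝ) [IsFiniteMeasure ν] (t : ℝ), Integrable (fun ω => Real.cos (ω * t)) ν := by
    intro ν _ t
    exact (integrable_const (1 : ℝ)).mono'
      (Real.continuous_cos.comp (continuous_id.mul continuous_const)).aestronglyMeasurable
      (Eventually.of_forall fun ω => by rw [Real.norm_eq_abs]; exact Real.abs_cos_le_one _)
  refine ⟨σ₁ + Measure.dirac 2, C, inferInstance, fun t => ?_, ⟨1, gauss, one_pos, hgc.continuousOn,
    fun ω _ => (Real.exp_pos _).le, by simp [hgauss], ?_⟩, ?_⟩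
  · -- the cosine transform
    rw [integral_add_measure (hcosint σ₁ t) (hcosint _ t), integral_dirac]
    rw [hσ₁, integral_withDensity_eq_integral_toReal_smul hgm (Eventually.of_forall fun _ => ENNReal.ofReal_lt_top)]
    have : (fun ω => (ENNReal.ofReal (gauss ω)).toReal • Real.cos (ω * t)) =
        fun ω => Real.cos (ω * t) * Real.exp (-(ω ^ 2 / 2)) := by
      funext ω
      rw [ENNReal.toReal_ofReal (Real.exp_pos _).le, smul_eq_mul, mul_comm]
    rw [this, integral_cos_mul_gaussian]
  · -- the window
    rw [Measure.restrict_add, hσ₁, restrict_withDensity measurableSet_Ioo]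
    have h0 : (Measure.dirac (2 : ℝ)).restrict (Ioo (-1) 1) = 0 := by
      rw [Measure.restrict_eq_zero, Measure.dirac_apply' _ measurableSet_Ioo, indicator_of_notMem]
      norm_num
    rw [h0, add_zero]
  · -- not integrable
    intro hint
    have hA : IntegrableOn (fun t : ℝ => Real.sqrt (2 * π) * Real.exp (-(t ^ 2 / 2))) (Ioi 0) :=
      (integrable_gaussian.const_mul _).integrableOn
    have hB : IntegrableOn (fun t : ℝ => Real.cos (2 * t)) (Ioi 0) := by
      have h := hint.sub hA
      refine h.congr_fun (fun t _ => ?_) measurableSet_Ioi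
      simp only [hCdef, Pi.sub_apply]
      ring
    exact not_integrableOn_cos_two_mul hB

end WindowNotL1

end Summit.AtomisticToContinuum.FouriersLaw.Cruxes.DrudeDissolution.Disproof

end
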